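import Summits.ResolutionOfSingularities.ResolutionOfSingularities.Theorems.WildConesCampaignW46HypersurfacesCharTwoEmbDimStatement
import Summits.ResolutionOfSingularities.ResolutionOfSingularities.Theorems.WildConesCampaignW46HypersurfacesCharTwoEmbDimDynamics

/-!
# [OURS · L1 W4.6, rung (ii) at p = 2, every dimension] The embedding-dimension predicates of
# `…HypersurfacesCharTwoEmbDimStatement.lean` PROVED at `p = 2`, BY NAME, for every `n`

Cell res-hironaka (LADDER-RESOLUTION rung L, D-0089), slot W4.6, seat res-L1-s46-pv-4 (gen 3). Host: route
`WildCones`, crux `ClassicalRegimes` (stmt-ResolutionOfSingularities-16884; proved), `--supports … --as helper`.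

HONEST FRAMING. OURS throughout: the eight campaign predicates of
`Theorems/WildConesCampaignW46HypersurfacesCharTwoEmbDimStatement.lean` (p501076, typed by this seat in the pattern of
OURS-desk #64) are closed here at `p = 2` for EVERY dimension `n` by one-line applications of the theorems of
`Theorems/WildConesCampaignW46HypersurfacesCharTwoEmbDim{,States,Dynamics}.lean` (p500816, p501431, p501990). Nothing
here is a statement of the manuscript [Hironaka2017]; no FACT-LIST premise is used; every field of characteristic `2`
(no `PerfectField`). AI review is weaker than expert review.

* `campaignW46HypersurfacesEmbDimClosed_two n`      — `CampaignW46HypersurfacesEmbDimClosed 2 n`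
* `campaignW46HypersurfacesEmbDimTrichotomy_two n`  — `CampaignW46HypersurfacesEmbDimTrichotomy 2 n`
* `campaignW46HypersurfacesEmbDimParity_two n`      — `CampaignW46HypersurfacesEmbDimParity 2 n`
* `campaignW46HypersurfacesEmbDimOrdP_two n`        — `CampaignW46HypersurfacesEmbDimOrdP 2 n`
* `campaignW46HypersurfacesEmbDimZero_two n`        — `CampaignW46HypersurfacesEmbDimZero 2 n`
* `campaignW46HypersurfacesEmbDimOne_two n`         — `CampaignW46HypersurfacesEmbDimOne 2 n`
* `campaignW46HypersurfacesEmbDimResolves_two n`    — `CampaignW46HypersurfacesEmbDimResolves 2 n`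
* `campaignW46ThreefoldsEmbDimIffOrdP_two`          — `CampaignW46ThreefoldsEmbDimIffOrdP 2`

References: the statement file p501076; G.-M. Greuel, G. Pfister, J. Algebra 689 (2026) [GreuelPfister2026] (through
the tree's `pair_reduction`); H. Hironaka, ms. 2017 [Hironaka2017] Th. 16.6 p.84 / Th. 16.13 p.87 — role replaced
only, under adjudication.
-/

noncomputable section

-- single-problem summit: the doubled namespace component `ResolutionOfSingularities` is forced
set_option linter.dupNamespace false

namespace Summit.ResolutionOfSingularities.ResolutionOfSingularities.Theorems

open CampaignW46 CampaignW46.HypersurfacesCharTwo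

/-- [OURS · L1 W4.6 rung (ii), every `n`; NOT a statement of the manuscript] `CampaignW46HypersurfacesEmbDimClosed 2 n`
holds: closure of the regime `MultP ∧ Isol ∧ e ≤ 1` with `μ' + 2 = μ`, `e' = e` (`hypersurface_regime_step`).
[cite: GreuelPfister2026, Thm 3.5 and Cor 3.7] -/
theorem campaignW46HypersurfacesEmbDimClosed_two (n : ℕ) : CampaignW46HypersurfacesEmbDimClosed 2 n :=
  fun _ _ _ c i τ hM hI he hM' => hypersurface_regime_step c i τ hM hI he hM'

/-- [OURS · L1 W4.6 rung (ii), every `n`; NOT a statement of the manuscript]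
`CampaignW46HypersurfacesEmbDimTrichotomy 2 n` holds (`hypersurface_trichotomy`). [folklore] -/
theorem campaignW46HypersurfacesEmbDimTrichotomy_two (n : ℕ) : CampaignW46HypersurfacesEmbDimTrichotomy 2 n :=
  fun _ _ _ c i τ hM hI hM' => hypersurface_trichotomy c i τ hM hI hM'

/-- [OURS · L1 W4.6 rung (ii), every `n`; NOT a statement of the manuscript] `CampaignW46HypersurfacesEmbDimParity 2 n`
holds: `e ≤ n`, `e ≡ n (mod 2)` (`milnorEmbDim_le_and_mod_two`). [folklore] -/
theorem campaignW46HypersurfacesEmbDimParity_two (n : ℕ) : CampaignW46HypersurfacesEmbDimParity 2 n :=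
  fun _ _ _ _ hM => ⟨(milnorEmbDim_le_and_mod_two hM).1, (milnorEmbDim_le_and_mod_two hM).2.1⟩

/-- [OURS · L1 W4.6 rung (ii), every `n`; NOT a statement of the manuscript] `CampaignW46HypersurfacesEmbDimOrdP 2 n`
holds: `OrdP ↔ e + 2 ≤ n` (`ordP_iff_milnorEmbDim_add_two_le`). [folklore] -/
theorem campaignW46HypersurfacesEmbDimOrdP_two (n : ℕ) : CampaignW46HypersurfacesEmbDimOrdP 2 n :=
  fun _ _ _ _ hM => ordP_iff_milnorEmbDim_add_two_le hM

/-- [OURS · L1 W4.6 rung (ii), every `n`; NOT a statement of the manuscript] `CampaignW46HypersurfacesEmbDimZero 2 n`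
holds: `e = 0 ↔ Isol ∧ μ = 1`, and then no double successor (`milnorEmbDim_eq_zero_iff`,
`hypersurface_not_multP_step_of_milnorEmbDim_eq_zero`). [folklore] -/
theorem campaignW46HypersurfacesEmbDimZero_two (n : ℕ) : CampaignW46HypersurfacesEmbDimZero 2 n :=
  fun _ _ _ c hM => ⟨milnorEmbDim_eq_zero_iff hM,
    fun he i τ => hypersurface_not_multP_step_of_milnorEmbDim_eq_zero c hM he i τ⟩

/-- [OURS · L1 W4.6 rung (ii), every `n`; NOT a statement of the manuscript] `CampaignW46HypersurfacesEmbDimOne 2 n`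
holds: `e = 1 ⇒ μ` even, `μ ≥ 2`, Milnor algebra `≅ κ⟦X⟧/(X^μ)` (`curvilinear_of_milnorEmbDim_eq_one`).
[cite: GreuelPfister2026, Thm 3.5 and Cor 3.7] -/
theorem campaignW46HypersurfacesEmbDimOne_two (n : ℕ) : CampaignW46HypersurfacesEmbDimOne 2 n :=
  fun _ _ _ _ hM hI h1 => curvilinear_of_milnorEmbDim_eq_one hM hI h1

/-- [OURS · L1 W4.6 rung (ii), every `n`; NOT a statement of the manuscript]
`CampaignW46HypersurfacesEmbDimResolves 2 n` holds: a smooth point within `(μ + 1)/2` blow-ups along every branch,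
`n ≥ 2` (`hypersurface_smooth_le_half`). [folklore] -/
theorem campaignW46HypersurfacesEmbDimResolves_two (n : ℕ) : CampaignW46HypersurfacesEmbDimResolves 2 n :=
  fun hn _ _ _ c₀ i t hM hI he => by
    obtain ⟨m, h2m, -, hk, hA⟩ := hypersurface_smooth_le_half hn c₀ i t hM hI he
    exact ⟨m, h2m, hA, hk⟩

/-- [OURS · L1 W4.6 rung (ii); NOT a statement of the manuscript] `CampaignW46ThreefoldsEmbDimIffOrdP 2` holds: for
threefold double points `e ≤ 1 ↔ OrdP` (`threefold_milnorEmbDim_le_one_iff_ordP`) — desk #64's regime is the `n = 3`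
instance of the every-dimension regime. [folklore] -/
theorem campaignW46ThreefoldsEmbDimIffOrdP_two : CampaignW46ThreefoldsEmbDimIffOrdP 2 :=
  fun _ _ _ _ hM => threefold_milnorEmbDim_le_one_iff_ordP hM

/-- [OURS · L1 W4.6 rung (ii); NOT a statement of the manuscript] All eight predicates at `p = 2`, every dimension
at once. [folklore] -/
theorem campaignW46HypersurfacesEmbDim_two_all :
    (∀ n, CampaignW46HypersurfacesEmbDimClosed 2 n) ∧ (∀ n, CampaignW46HypersurfacesEmbDimTrichotomy 2 n) ∧
      (∀ n, CampaignW46HypersurfacesEmbDimParity 2 n) ∧ (∀ n, CampaignW46HypersurfacesEmbDimOrdP 2 n) ∧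
      (∀ n, CampaignW46HypersurfacesEmbDimZero 2 n) ∧ (∀ n, CampaignW46HypersurfacesEmbDimOne 2 n) ∧
      (∀ n, CampaignW46HypersurfacesEmbDimResolves 2 n) ∧ CampaignW46ThreefoldsEmbDimIffOrdP 2 :=
  ⟨campaignW46HypersurfacesEmbDimClosed_two, campaignW46HypersurfacesEmbDimTrichotomy_two,
    campaignW46HypersurfacesEmbDimParity_two, campaignW46HypersurfacesEmbDimOrdP_two,
    campaignW46HypersurfacesEmbDimZero_two, campaignW46HypersurfacesEmbDimOne_two,
    campaignW46HypersurfacesEmbDimResolves_two, campaignW46ThreefoldsEmbDimIffOrdP_two⟩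

end Summit.ResolutionOfSingularities.ResolutionOfSingularities.Theorems

end
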